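import Mathlib.RingTheory.AdicCompletion.LocalRing
import Mathlib.RingTheory.AdicCompletion.RingHom
import Mathlib.RingTheory.AdicCompletion.Exactness
import Mathlib.RingTheory.AdicCompletion.Noetherian
import Mathlib.RingTheory.LocalRing.ResidueField.Basic
import Mathlib.RingTheory.LocalRing.RingHom.Basic
import Mathlib.RingTheory.MvPolynomial.Basic
import Mathlib.RingTheory.Ideal.Quotient.Noetherian
import Literature.AlgebraicGeometry.Resolution.AdicNoetherian
import Literature.AlgebraicGeometry.Resolution.FormalFibres
import HarnessLib

/-!
# Coefficient `𝒪`-algebras with residue field `k` and completed polynomial algebras (Mazur, §2)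

Topic `Literature/NumberTheory/GaloisRepresentations`.  Infrastructure for the construction of
universal deformation rings (the named fact `nearlyOrdinaryDeformationRing_nonempty` of
`NearlyOrdinaryDeformationRing.lean`, after Calegari–Mazur §2.2 and Mazur §20 Prop. 2), step 2:
Mazur's category `Ĉ_Λ(k)` of coefficient-`Λ`-algebras ("complete noetherian local `Λ`-algebras
`A` with residue field `k`", [Maz, §2]; here `Λ = 𝒪`) and the completed polynomial algebras that
play the role of the power series rings `Λ[[X₁, …, X_n]]` in the proof of representability.

* `Deformation.CNLAlgebra 𝒪 k` — an object of `Ĉ_𝒪(k)`: a complete Noetherian local `𝒪`-algebra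
  with an augmentation `residue : A →ₐ[𝒪] k` ONTO `k`; basic API (`ker_residue`,
  `algHom_residueField_unique`: augmentations are unique when `𝒪 → k` is onto, hence every
  `𝒪`-algebra map is local, `map_maximalIdeal_le`; `eq_of_forall_mk_eq`), the objects `k`
  (`CNLAlgebra.self`), quotients `A/𝔞` (`CNLAlgebra.quotient`, complete by the tree's
  `Literature.AlgebraicGeometry.Resolution.isAdicComplete_quotient`, Matsumura §32 p. 257) and
  truncations `A/𝔪^{n+1}` (`trunc`, `toTrunc`).
* `Deformation.PowerSeriesAt 𝒪 c` — for a `k`-point `c : σ → k`, the completion `𝒪[X_s]^_c` of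
  the polynomial ring at the maximal ideal `𝔫_c = ker (X_s ↦ c_s)` (`pointIdeal`); it is an object
  of `Ĉ_𝒪(k)` (`PowerSeriesAt.toCNL`: Noetherian by the tree's Stacks 0316
  `Literature.AlgebraicGeometry.Resolution.Stacks0316`, complete and local by Mathlib's
  `AdicCompletion` API) and satisfies the **universal property** of `𝒪[[X_s - c_s]]`: for
  `A ∈ Ĉ_𝒪(k)` and `a : σ → A` with `π_A(a_s) = c_s` there is a unique `𝒪`-algebra map
  `𝒪[X_s]^_c → A` with `X_s ↦ a_s` (`PowerSeriesAt.lift`, `lift_X`, `algHom_ext`, `lift_unique`).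

Everything is proved; no named facts.

## References

* [Maz] B. Mazur, *An introduction to the deformation theory of Galois representations*, in
  Modular Forms and Fermat's Last Theorem (Springer 1997), §2 (coefficient rings and
  coefficient-`Λ`-algebras), §20 Prop. 2. [cite: Mazur1997Deformation, §2]
* H. Matsumura, *Commutative Ring Theory*, CUP 1986, §8 (completion), §32 p. 257.
  [cite: Matsumura1987, §32 p. 257]
* The Stacks Project, Tags 0316, 05GG. [cite: StacksProject, Tag 0316]
-/

noncomputable section

open IsLocalRing

namespace Literature.NumberTheory.GaloisRepresentations.Deformation

universe u

variable (𝒪 : Type u) [CommRing 𝒪] (k : Type u) [Field k] [Algebra 𝒪 k]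

/-- Mazur's category `Ĉ_Λ(k)` of **complete Noetherian local `𝒪`-algebras with residue field
`k`**, an object being a complete Noetherian local `𝒪`-algebra `A` together with an augmentation
`A →ₐ[𝒪] k` ONTO `k` (so that `A/𝔪_A = k`). [cite: Mazur1997Deformation, §2 and §10] -/
structure CNLAlgebra : Type (u + 1) where
  /-- The underlying type. -/
  carrier : Type u
  [commRing : CommRing carrier]
  [isLocalRing : IsLocalRing carrier]
  [isNoetherianRing : IsNoetherianRing carrier]
  [algebra : Algebra 𝒪 carrier]
  [isAdicComplete : IsAdicComplete (maximalIdeal carrier) carrier]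
  /-- The augmentation onto the residue field `k`. -/
  residue : carrier →ₐ[𝒪] k
  residue_surjective : Function.Surjective residue

namespace CNLAlgebra

attribute [instance] commRing isLocalRing isNoetherianRing algebra isAdicComplete

/-- An object of `Ĉ_𝒪(k)` coerces to its underlying type. [folklore] -/
instance : CoeSort (CNLAlgebra 𝒪 k) (Type u) := ⟨CNLAlgebra.carrier⟩

variable {𝒪 k}

/-- The kernel of the augmentation is the maximal ideal. [cite: Mazur1997Deformation, §2] -/
theorem ker_residue (A : CNLAlgebra 𝒪 k) : RingHom.ker (A.residue : A →+* k) = maximalIdeal A :=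
  IsLocalRing.ker_eq_maximalIdeal _ A.residue_surjective

/-- `a ∈ 𝔪_A ↔ π_A a = 0`. [folklore] -/
theorem mem_maximalIdeal_iff (A : CNLAlgebra 𝒪 k) {a : A} : a ∈ maximalIdeal A ↔ A.residue a = 0 := by
  rw [← ker_residue, RingHom.mem_ker]; rfl

section Unique

variable (hk : Function.Surjective (algebraMap 𝒪 k))
include hk

/-- **Augmentations are unique**: a local `𝒪`-algebra admits at most one `𝒪`-algebra map to `k`
when `𝒪 → k` is onto. [cite: Mazur1997Deformation, §2] -/
theorem algHom_residueField_unique {B : Type*} [CommRing B] [IsLocalRing B] [Algebra 𝒪 B]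
    (f g : B →ₐ[𝒪] k) : f = g := by
  have hsurj : ∀ e : B →ₐ[𝒪] k, Function.Surjective e := fun e x => by
    obtain ⟨o, rfl⟩ := hk x
    exact ⟨algebraMap 𝒪 B o, e.commutes o⟩
  have hf := IsLocalRing.ker_eq_maximalIdeal (f : B →+* k) (hsurj f)
  have hg := IsLocalRing.ker_eq_maximalIdeal (g : B →+* k) (hsurj g)
  ext b
  obtain ⟨o, ho⟩ := hk (f b)
  have hb : b - algebraMap 𝒪 B o ∈ RingHom.ker (f : B →+* k) := by
    rw [RingHom.mem_ker, RingHom.coe_coe, map_sub, AlgHom.commutes, ho, sub_self]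
  rw [hf, ← hg, RingHom.mem_ker, RingHom.coe_coe, map_sub, AlgHom.commutes, sub_eq_zero] at hb
  rw [hb, ho]

/-- Every `𝒪`-algebra map between objects of `Ĉ_𝒪(k)` is compatible with the augmentations.
[cite: Mazur1997Deformation, §2] -/
theorem residue_comp {A B : CNLAlgebra 𝒪 k} (φ : A →ₐ[𝒪] B) : B.residue.comp φ = A.residue :=
  algHom_residueField_unique hk _ _

/-- `π_B (φ a) = π_A a` for every morphism `φ`. [cite: Mazur1997Deformation, §2] -/
theorem residue_map {A B : CNLAlgebra 𝒪 k} (φ : A →ₐ[𝒪] B) (a : A) : B.residue (φ a) = A.residue a :=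
  DFunLike.congr_fun (residue_comp hk φ) a

/-- … hence is a local homomorphism: `φ(𝔪_A) ⊆ 𝔪_B`. [cite: Mazur1997Deformation, §2] -/
theorem map_maximalIdeal_le {A B : CNLAlgebra 𝒪 k} (φ : A →ₐ[𝒪] B) :
    (maximalIdeal A).map (φ : A →+* B) ≤ maximalIdeal B := by
  rw [Ideal.map_le_iff_le_comap]
  intro a ha
  rw [Ideal.mem_comap, mem_maximalIdeal_iff, RingHom.coe_coe, residue_map hk φ]
  exact (mem_maximalIdeal_iff A).1 ha

/-- `φ(𝔪_A^n) ⊆ 𝔪_B^n`. [folklore] -/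
theorem map_pow_maximalIdeal_le {A B : CNLAlgebra 𝒪 k} (φ : A →ₐ[𝒪] B) (n : ℕ) :
    (maximalIdeal A ^ n).map (φ : A →+* B) ≤ maximalIdeal B ^ n := by
  rw [Ideal.map_pow]
  exact Ideal.pow_right_mono (map_maximalIdeal_le hk φ) n

end Unique

/-- Two elements of a complete (Hausdorff) local ring agreeing modulo every power of the maximal
ideal are equal. [folklore] -/
theorem eq_of_forall_mk_eq (A : CNLAlgebra 𝒪 k) {x y : A}
    (h : ∀ n, Ideal.Quotient.mk (maximalIdeal A ^ n) x = Ideal.Quotient.mk (maximalIdeal A ^ n) y) :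
    x = y := by
  rw [← sub_eq_zero]
  refine IsHausdorff.haus (IsAdicComplete.toIsHausdorff (I := maximalIdeal A) (M := A)) _ fun n => ?_
  rw [SModEq.zero, smul_eq_mul, Ideal.mul_top, ← Ideal.Quotient.eq_zero_iff_mem, map_sub, h n,
    sub_self]

/-! #### The residue field itself -/

variable (𝒪 k) in
/-- `k` is an object of `Ĉ_𝒪(k)` (a field is an Artinian, hence complete, local ring).
[cite: Mazur1997Deformation, §2] -/
@[reducible] def self : CNLAlgebra 𝒪 k where
  carrier := k
  residue := AlgHom.id 𝒪 k
  residue_surjective := Function.surjective_id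

/-- The underlying type of the object `k`. [folklore] -/
@[simp] theorem self_carrier : (self 𝒪 k : Type u) = k := rfl

/-- The augmentation of the object `k` is the identity. [folklore] -/
@[simp] theorem self_residue : (self 𝒪 k).residue = AlgHom.id 𝒪 k := rfl

/-! #### Quotients -/

/-- The quotient `A/𝔞` of an object of `Ĉ_𝒪(k)` by a proper ideal, with the induced augmentation.
[cite: Mazur1997Deformation, §2] -/
def quotient (A : CNLAlgebra 𝒪 k) (𝔞 : Ideal A) (h𝔞 : 𝔞 ≠ ⊤) : CNLAlgebra 𝒪 k :=
  haveI : Nontrivial (A ⧸ 𝔞) := Ideal.Quotient.nontrivial_iff.mpr h𝔞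
  haveI : IsLocalRing (A ⧸ 𝔞) := IsLocalRing.of_surjective' _ Ideal.Quotient.mk_surjective
  haveI : IsAdicComplete (maximalIdeal (A ⧸ 𝔞)) (A ⧸ 𝔞) :=
    Literature.AlgebraicGeometry.Resolution.isAdicComplete_quotient 𝔞
  { carrier := A ⧸ 𝔞
    residue := Ideal.Quotient.liftₐ 𝔞 A.residue fun a ha => by
      rw [← mem_maximalIdeal_iff]
      exact IsLocalRing.le_maximalIdeal h𝔞 ha
    residue_surjective := by
      intro x
      obtain ⟨a, ha⟩ := A.residue_surjective x
      exact ⟨Ideal.Quotient.mk 𝔞 a, by simpa [Ideal.Quotient.liftₐ_apply] using ha⟩ }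

/-- The underlying type of `A/𝔞`. [folklore] -/
@[simp] theorem quotient_carrier (A : CNLAlgebra 𝒪 k) (𝔞 : Ideal A) (h𝔞 : 𝔞 ≠ ⊤) :
    (A.quotient 𝔞 h𝔞 : Type u) = (A ⧸ 𝔞) := rfl

/-- The augmentation of `A/𝔞` on residue classes. [folklore] -/
theorem quotient_residue_mk (A : CNLAlgebra 𝒪 k) (𝔞 : Ideal A) (h𝔞 : 𝔞 ≠ ⊤) (a : A) :
    (A.quotient 𝔞 h𝔞).residue (Ideal.Quotient.mk 𝔞 a) = A.residue a := by
  change Ideal.Quotient.liftₐ 𝔞 A.residue _ (Ideal.Quotient.mk 𝔞 a) = A.residue a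
  rw [Ideal.Quotient.liftₐ_apply, Ideal.Quotient.lift_mk]
  rfl

/-- The quotient map `A → A/𝔞` as a morphism of `Ĉ_𝒪(k)`. [folklore] -/
def toQuotient (A : CNLAlgebra 𝒪 k) (𝔞 : Ideal A) (h𝔞 : 𝔞 ≠ ⊤) : A →ₐ[𝒪] A.quotient 𝔞 h𝔞 :=
  Ideal.Quotient.mkₐ 𝒪 𝔞

/-- Unfolding lemma for `toQuotient`. [folklore] -/
@[simp] theorem toQuotient_apply (A : CNLAlgebra 𝒪 k) (𝔞 : Ideal A) (h𝔞 : 𝔞 ≠ ⊤) (a : A) :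
    A.toQuotient 𝔞 h𝔞 a = Ideal.Quotient.mk 𝔞 a := rfl

/-- `𝔪_A^n` is a proper ideal unless `n = 0`. [folklore] -/
theorem pow_maximalIdeal_ne_top (A : CNLAlgebra 𝒪 k) (n : ℕ) : maximalIdeal A ^ n ≠ ⊤ ∨ n = 0 := by
  rcases Nat.eq_zero_or_pos n with hn | hn
  · exact Or.inr hn
  · left
    exact fun h => (maximalIdeal.isMaximal A).ne_top
      (top_le_iff.1 (h ▸ Ideal.pow_le_self hn.ne'))

/-- `𝔪_A^{n+1}` is a proper ideal. [folklore] -/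
theorem pow_succ_maximalIdeal_ne_top (A : CNLAlgebra 𝒪 k) (n : ℕ) : maximalIdeal A ^ (n + 1) ≠ ⊤ :=
  fun h => (maximalIdeal.isMaximal A).ne_top (top_le_iff.1 (h ▸ Ideal.pow_le_self n.succ_ne_zero))

/-- The truncation `A/𝔪_A^{n+1}` (an Artinian object of `Ĉ_𝒪(k)`). [cite: Mazur1997Deformation, §2] -/
def trunc (A : CNLAlgebra 𝒪 k) (n : ℕ) : CNLAlgebra 𝒪 k :=
  A.quotient (maximalIdeal A ^ (n + 1)) (A.pow_succ_maximalIdeal_ne_top n)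

/-- The underlying type of `A/𝔪_A^{n+1}`. [folklore] -/
@[simp] theorem trunc_carrier (A : CNLAlgebra 𝒪 k) (n : ℕ) :
    (A.trunc n : Type u) = (A ⧸ maximalIdeal A ^ (n + 1)) := rfl

/-- The truncation map `A → A/𝔪_A^{n+1}`. [folklore] -/
def toTrunc (A : CNLAlgebra 𝒪 k) (n : ℕ) : A →ₐ[𝒪] A.trunc n :=
  A.toQuotient (maximalIdeal A ^ (n + 1)) (A.pow_succ_maximalIdeal_ne_top n)

/-- Unfolding lemma for `toTrunc`. [folklore] -/
@[simp] theorem toTrunc_apply (A : CNLAlgebra 𝒪 k) (n : ℕ) (a : A) :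
    A.toTrunc n a = Ideal.Quotient.mk (maximalIdeal A ^ (n + 1)) a := rfl

/-- `a ↦ 0` in `A/𝔪_A^{n+1}` iff `a ∈ 𝔪_A^{n+1}`. [folklore] -/
theorem toTrunc_eq_zero_iff (A : CNLAlgebra 𝒪 k) (n : ℕ) (a : A) :
    A.toTrunc n a = 0 ↔ a ∈ maximalIdeal A ^ (n + 1) := Ideal.Quotient.eq_zero_iff_mem

end CNLAlgebra

/-! ### Completed polynomial algebras at a `k`-rational point -/

section PowerSeriesAt

variable {k}
variable {σ : Type u} (c : σ → k)

/-- Evaluation of polynomials over `𝒪` at the `k`-point `c`. [folklore] -/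
def evalAt : MvPolynomial σ 𝒪 →ₐ[𝒪] k := MvPolynomial.aeval c

/-- `evalAt` on variables. [folklore] -/
@[simp] theorem evalAt_X (s : σ) : evalAt 𝒪 c (MvPolynomial.X s) = c s := MvPolynomial.aeval_X _ _

/-- The maximal ideal `𝔫_c = ker (P → k, X_s ↦ c_s)` of the `k`-point `c` of `Spec 𝒪[X_s]`.
[folklore] -/
def pointIdeal : Ideal (MvPolynomial σ 𝒪) := RingHom.ker (evalAt 𝒪 c : MvPolynomial σ 𝒪 →+* k)

/-- Membership in the point ideal. [folklore] -/
theorem mem_pointIdeal_iff {f : MvPolynomial σ 𝒪} : f ∈ pointIdeal 𝒪 c ↔ evalAt 𝒪 c f = 0 :=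
  RingHom.mem_ker

variable {𝒪}
variable (hk : Function.Surjective (algebraMap 𝒪 k))

include hk in
/-- `evalAt` is onto when `𝒪 → k` is. [folklore] -/
theorem evalAt_surjective : Function.Surjective (evalAt 𝒪 c) := fun x => by
  obtain ⟨o, rfl⟩ := hk x
  exact ⟨algebraMap 𝒪 _ o, AlgHom.commutes _ o⟩

include hk in
/-- The point ideal is maximal when `𝒪 → k` is onto. [folklore] -/
theorem pointIdeal_isMaximal : (pointIdeal 𝒪 c).IsMaximal :=
  RingHom.ker_isMaximal_of_surjective (evalAt 𝒪 c : MvPolynomial σ 𝒪 →+* k)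
    (evalAt_surjective c hk)

variable (𝒪)

/-- **The completed polynomial algebra `𝒪[X_s]^_c` at the `k`-point `c`** — for `c = 0` this is the
power series ring `𝒪[[X_s]]`; in general it is the complete Noetherian local `𝒪`-algebra
representing `A ↦ {a : σ → A | a_s ≡ c_s mod 𝔪_A}` on `Ĉ_𝒪(k)` (`PowerSeriesAt.lift`,
`PowerSeriesAt.algHom_ext`). [cite: Mazur1997Deformation, §2] -/
abbrev PowerSeriesAt : Type u := AdicCompletion (pointIdeal 𝒪 c) (MvPolynomial σ 𝒪)

namespace PowerSeriesAt

/-- The variable `X_s` in the completion. [folklore] -/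
def X (s : σ) : PowerSeriesAt 𝒪 c :=
  algebraMap (MvPolynomial σ 𝒪) (PowerSeriesAt 𝒪 c) (MvPolynomial.X s)

/-- `𝒪 → 𝒪[X] → 𝒪[X]^_c` is a scalar tower. [folklore] -/
instance instIsScalarTower : IsScalarTower 𝒪 (MvPolynomial σ 𝒪) (PowerSeriesAt 𝒪 c) :=
  IsScalarTower.of_algebraMap_eq fun _ => rfl

/-- The structure map sends `X_s` to `X_s`. [folklore] -/
theorem toAlgHom_X (s : σ) :
    IsScalarTower.toAlgHom 𝒪 (MvPolynomial σ 𝒪) (PowerSeriesAt 𝒪 c) (MvPolynomial.X s) =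
      X 𝒪 c s := rfl

/-- The augmentation `𝒪[X]^_c → k`: `evalOne` to `P/𝔫_c`, then `P/𝔫_c → k`. [folklore] -/
def residue : PowerSeriesAt 𝒪 c →ₐ[𝒪] k :=
  (Ideal.Quotient.liftₐ (pointIdeal 𝒪 c) (evalAt 𝒪 c) fun _ h => h).comp
    ((AdicCompletion.evalOneₐ (pointIdeal 𝒪 c)).restrictScalars 𝒪)

/-- The augmentation of `𝒪[X]^_c` on polynomials is evaluation at `c`. [folklore] -/
theorem residue_algebraMap (f : MvPolynomial σ 𝒪) :
    residue 𝒪 c (algebraMap _ (PowerSeriesAt 𝒪 c) f) = evalAt 𝒪 c f := by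
  have h1 : AdicCompletion.evalOneₐ (pointIdeal 𝒪 c) (algebraMap _ (PowerSeriesAt 𝒪 c) f) =
      Ideal.Quotient.mk _ f :=
    AdicCompletion.evalOneₐ_of _ f
  simp only [residue, AlgHom.comp_apply, AlgHom.restrictScalars_apply, h1,
    Ideal.Quotient.liftₐ_apply, Ideal.Quotient.lift_mk]
  rfl

/-- The augmentation sends `X_s` to `c_s`. [folklore] -/
@[simp] theorem residue_X (s : σ) : residue 𝒪 c (X 𝒪 c s) = c s := by
  rw [X, residue_algebraMap, evalAt_X]

variable {𝒪} in
include hk in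
/-- The augmentation of `𝒪[X]^_c` is onto. [folklore] -/
theorem residue_surjective : Function.Surjective (residue 𝒪 c) := fun x => by
  obtain ⟨o, rfl⟩ := hk x
  exact ⟨algebraMap 𝒪 _ o, AlgHom.commutes _ o⟩

/-! #### The universal property: existence of lifts -/

section Lift

variable {𝒪 c}
variable (A : CNLAlgebra 𝒪 k) (a : σ → A)

/-- The polynomial-level evaluation `X_s ↦ a_s`. [folklore] -/
def liftPoly : MvPolynomial σ 𝒪 →ₐ[𝒪] A := MvPolynomial.aeval a

/-- `liftPoly` on variables. [folklore] -/
@[simp] theorem liftPoly_X (s : σ) : liftPoly A a (MvPolynomial.X s) = a s :=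
  MvPolynomial.aeval_X _ _

variable (ha : ∀ s, A.residue (a s) = c s)
include ha

/-- `π_A ∘ liftPoly = evalAt c`. [folklore] -/
theorem residue_comp_liftPoly : A.residue.comp (liftPoly A a) = evalAt 𝒪 c := by
  refine MvPolynomial.algHom_ext fun s => ?_
  rw [AlgHom.comp_apply, liftPoly_X, ha, evalAt_X]

/-- `liftPoly` sends the point ideal into `𝔪_A`. [folklore] -/
theorem map_pointIdeal_le : (pointIdeal 𝒪 c).map (liftPoly A a : MvPolynomial σ 𝒪 →+* A) ≤
    maximalIdeal A := by
  rw [Ideal.map_le_iff_le_comap]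
  intro f hf
  rw [Ideal.mem_comap, CNLAlgebra.mem_maximalIdeal_iff, RingHom.coe_coe, ← AlgHom.comp_apply,
    residue_comp_liftPoly A a ha]
  exact (mem_pointIdeal_iff 𝒪 c).1 hf

/-- `liftPoly` sends `𝔫_c^n` into `𝔪_A^n`. [folklore] -/
theorem map_pow_pointIdeal_le (n : ℕ) :
    (pointIdeal 𝒪 c ^ n).map (liftPoly A a : MvPolynomial σ 𝒪 →+* A) ≤ maximalIdeal A ^ n := by
  rw [Ideal.map_pow]
  exact Ideal.pow_right_mono (map_pointIdeal_le A a ha) n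

/-- Level-`n` evaluation `P/𝔫^n → A/𝔪_A^n`. [folklore] -/
def liftQuot (n : ℕ) : (MvPolynomial σ 𝒪 ⧸ pointIdeal 𝒪 c ^ n) →ₐ[𝒪] A ⧸ maximalIdeal A ^ n :=
  Ideal.Quotient.liftₐ (pointIdeal 𝒪 c ^ n)
    ((Ideal.Quotient.mkₐ 𝒪 (maximalIdeal A ^ n)).comp (liftPoly A a)) fun f hf => by
      rw [AlgHom.comp_apply, Ideal.Quotient.mkₐ_eq_mk, Ideal.Quotient.eq_zero_iff_mem]
      exact map_pow_pointIdeal_le A a ha n (Ideal.mem_map_of_mem _ hf)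

/-- `liftQuot` on residue classes. [folklore] -/
@[simp] theorem liftQuot_mk (n : ℕ) (f : MvPolynomial σ 𝒪) :
    liftQuot A a ha n (Ideal.Quotient.mk _ f) = Ideal.Quotient.mk _ (liftPoly A a f) := by
  rw [liftQuot, Ideal.Quotient.liftₐ_apply, Ideal.Quotient.lift_mk]
  rfl

/-- Level-`n` evaluation on the completion, `𝒪[X]^_c → P/𝔫^n → A/𝔪_A^n`. [folklore] -/
def liftLevel (n : ℕ) : PowerSeriesAt 𝒪 c →ₐ[𝒪] A ⧸ maximalIdeal A ^ n :=
  (liftQuot A a ha n).comp ((AdicCompletion.evalₐ (pointIdeal 𝒪 c) n).restrictScalars 𝒪)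

/-- `liftLevel` on classes of Cauchy sequences. [folklore] -/
theorem liftLevel_mk (n : ℕ)
    (r : AdicCompletion.AdicCauchySequence (pointIdeal 𝒪 c) (MvPolynomial σ 𝒪)) :
    liftLevel A a ha n (AdicCompletion.mk (pointIdeal 𝒪 c) (MvPolynomial σ 𝒪) r) =
      Ideal.Quotient.mk _ (liftPoly A a (r.val n)) := by
  change liftQuot A a ha n (AdicCompletion.evalₐ (pointIdeal 𝒪 c) n
    (AdicCompletion.mk (pointIdeal 𝒪 c) (MvPolynomial σ 𝒪) r)) = _
  rw [AdicCompletion.evalₐ_mk, liftQuot_mk]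

/-- `liftLevel` on polynomials. [folklore] -/
theorem liftLevel_algebraMap (n : ℕ) (f : MvPolynomial σ 𝒪) :
    liftLevel A a ha n (algebraMap _ (PowerSeriesAt 𝒪 c) f) =
      Ideal.Quotient.mk _ (liftPoly A a f) := by
  change liftQuot A a ha n (AdicCompletion.evalₐ (pointIdeal 𝒪 c) n
    (AdicCompletion.of (pointIdeal 𝒪 c) (MvPolynomial σ 𝒪) f)) = _
  rw [AdicCompletion.evalₐ_of, liftQuot_mk]

/-- The level maps are compatible. [folklore] -/
theorem liftLevel_compat {m n : ℕ} (hle : m ≤ n) :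
    (Ideal.Quotient.factorₐ 𝒪 (Ideal.pow_le_pow_right hle)).comp (liftLevel A a ha n) =
      liftLevel A a ha m := by
  apply AlgHom.ext
  intro x
  obtain ⟨r, rfl⟩ := AdicCompletion.mk_surjective (pointIdeal 𝒪 c) _ x
  rw [AlgHom.comp_apply, liftLevel_mk, liftLevel_mk, Ideal.Quotient.factorₐ_apply,
    Ideal.Quotient.factor_mk, Ideal.Quotient.eq, ← map_sub]
  refine map_pow_pointIdeal_le A a ha m (Ideal.mem_map_of_mem _ ?_)
  rw [← Ideal.Quotient.eq]
  exact AdicCompletion.Ideal.mk_eq_mk _ hle r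

/-- **Universal property of `𝒪[X_s]^_c`, existence**: for `A ∈ Ĉ_𝒪(k)` and `a : σ → A` with
`a_s ≡ c_s`, the `𝒪`-algebra map `𝒪[X_s]^_c → A`, `X_s ↦ a_s`. [cite: Mazur1997Deformation, §2] -/
def lift : PowerSeriesAt 𝒪 c →ₐ[𝒪] A :=
  IsAdicComplete.liftAlgHom (maximalIdeal A) (liftLevel A a ha) (liftLevel_compat A a ha)

/-- `lift` reduces to `liftLevel n` modulo `𝔪_A^n`. [folklore] -/
theorem mk_lift (n : ℕ) (x : PowerSeriesAt 𝒪 c) :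
    Ideal.Quotient.mk (maximalIdeal A ^ n) (lift A a ha x) = liftLevel A a ha n x :=
  IsAdicComplete.mk_liftAlgHom _ _ _ n x

/-- `lift` on polynomials is `liftPoly`. [folklore] -/
theorem lift_algebraMap (f : MvPolynomial σ 𝒪) :
    lift A a ha (algebraMap _ (PowerSeriesAt 𝒪 c) f) = liftPoly A a f :=
  A.eq_of_forall_mk_eq fun n => by rw [mk_lift, liftLevel_algebraMap]

/-- `lift` sends `X_s` to `a_s`. [cite: Mazur1997Deformation, §2] -/
@[simp] theorem lift_X (s : σ) : lift A a ha (X 𝒪 c s) = a s := by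
  rw [X, lift_algebraMap, liftPoly_X]

end Lift

/-! #### `𝒪[X_s]^_c` is an object of `Ĉ_𝒪(k)` (finitely many variables, `𝒪` Noetherian) -/

variable [Finite σ] [IsNoetherianRing 𝒪]

/-- The point ideal is finitely generated (`𝒪` Noetherian, finitely many variables). [folklore] -/
theorem pointIdeal_fg : (pointIdeal 𝒪 c).FG := IsNoetherian.noetherian _

/-- `𝒪[X]^_c` is Noetherian (Stacks 0316, tree `AdicNoetherian`). [cite: StacksProject, Tag 0316] -/
instance isNoetherianRing : IsNoetherianRing (PowerSeriesAt 𝒪 c) :=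
  Literature.AlgebraicGeometry.Resolution.Stacks0316 (MvPolynomial σ 𝒪) _

/-- `𝒪[X]^_c` is `𝔫_c`-adically complete (Stacks 05GG). [cite: StacksProject, Tag 05GG] -/
theorem isAdicComplete_map :
    IsAdicComplete ((pointIdeal 𝒪 c).map (algebraMap _ (PowerSeriesAt 𝒪 c)))
      (PowerSeriesAt 𝒪 c) :=
  AdicCompletion.isAdicComplete_self _ (pointIdeal_fg 𝒪 c)

/-- Elements of the completion are polynomials modulo `𝔫^n`. [folklore] -/
theorem exists_sub_algebraMap_mem (n : ℕ) (x : PowerSeriesAt 𝒪 c) :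
    ∃ f : MvPolynomial σ 𝒪, x - algebraMap _ (PowerSeriesAt 𝒪 c) f ∈
      (pointIdeal 𝒪 c ^ n).map (algebraMap _ (PowerSeriesAt 𝒪 c)) := by
  obtain ⟨r, rfl⟩ := AdicCompletion.mk_surjective (pointIdeal 𝒪 c) _ x
  refine ⟨r.val n, ?_⟩
  set y := AdicCompletion.mk (pointIdeal 𝒪 c) (MvPolynomial σ 𝒪) r -
    algebraMap _ (PowerSeriesAt 𝒪 c) (r.val n) with hy
  have h1 : AdicCompletion.evalₐ (pointIdeal 𝒪 c) n y = 0 := by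
    rw [hy, map_sub, AdicCompletion.evalₐ_mk, AdicCompletion.algebraMap_apply,
      Algebra.algebraMap_self, RingHom.id_apply, AdicCompletion.evalₐ_of, sub_self]
  have h2 : y ∈ ((pointIdeal 𝒪 c) ^ n • ⊤ :
      Submodule (MvPolynomial σ 𝒪) (PowerSeriesAt 𝒪 c)) := by
    rw [AdicCompletion.pow_smul_top_eq_ker_eval (pointIdeal_fg 𝒪 c), LinearMap.mem_ker,
      ← AdicCompletion.factor_evalₐ_eq_eval (I := pointIdeal 𝒪 c) y (by simp), h1, map_zero]
  rwa [Ideal.smul_top_eq_map] at h2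

variable {𝒪}
include hk

/-- The extension of `𝔫_c` to the completion is maximal. [folklore] -/
theorem isMaximal_map : ((pointIdeal 𝒪 c).map (algebraMap _ (PowerSeriesAt 𝒪 c))).IsMaximal :=
  haveI := pointIdeal_isMaximal c hk
  AdicCompletion.isMaximal_map_of_le _ _ le_rfl (pointIdeal_fg 𝒪 c)

/-- `𝒪[X]^_c` is local. [folklore] -/
theorem isLocalRing : IsLocalRing (PowerSeriesAt 𝒪 c) :=
  haveI := isMaximal_map c hk
  haveI := isAdicComplete_map 𝒪 c
  isLocalRing_of_isAdicComplete_maximal ((pointIdeal 𝒪 c).map (algebraMap _ (PowerSeriesAt 𝒪 c)))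

/-- The maximal ideal of `𝒪[X]^_c` is the extension of `𝔫_c`. [folklore] -/
theorem maximalIdeal_eq :
    haveI := isLocalRing c hk
    maximalIdeal (PowerSeriesAt 𝒪 c) = (pointIdeal 𝒪 c).map (algebraMap _ (PowerSeriesAt 𝒪 c)) :=
  haveI := isLocalRing c hk
  (IsLocalRing.eq_maximalIdeal (isMaximal_map c hk)).symm

/-- `𝒪[X_s]^_c` as an object of `Ĉ_𝒪(k)`. [cite: Mazur1997Deformation, §2] -/
def toCNL : CNLAlgebra 𝒪 k :=
  haveI := isLocalRing c hk
  haveI : IsAdicComplete (maximalIdeal (PowerSeriesAt 𝒪 c)) (PowerSeriesAt 𝒪 c) := by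
    rw [maximalIdeal_eq c hk]
    exact isAdicComplete_map 𝒪 c
  { carrier := PowerSeriesAt 𝒪 c
    residue := residue 𝒪 c
    residue_surjective := residue_surjective c hk }

/-- The underlying type of `toCNL`. [folklore] -/
@[simp] theorem toCNL_carrier : (toCNL c hk : Type u) = PowerSeriesAt 𝒪 c := rfl

/-- The augmentation of `toCNL`. [folklore] -/
@[simp] theorem toCNL_residue : (toCNL c hk).residue = residue 𝒪 c := rfl

/-! #### The universal property: uniqueness -/

variable {c}
variable (A : CNLAlgebra 𝒪 k)

/-- Every `𝒪`-algebra map out of `𝒪[X_s]^_c` into an object of `Ĉ_𝒪(k)` is local, level by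
level. [cite: Mazur1997Deformation, §2] -/
theorem map_map_pow_pointIdeal_le (e : PowerSeriesAt 𝒪 c →ₐ[𝒪] A) (n : ℕ) :
    ((pointIdeal 𝒪 c ^ n).map (algebraMap _ (PowerSeriesAt 𝒪 c))).map (e : _ →+* A) ≤
      maximalIdeal A ^ n := by
  rw [Ideal.map_map]
  have he : ∀ s, A.residue (e (X 𝒪 c s)) = c s := fun s => by
    have h1 := CNLAlgebra.residue_map hk (A := toCNL c hk) (B := A) e (X 𝒪 c s)
    exact h1.trans (residue_X 𝒪 c s)
  have hcomp : (e : PowerSeriesAt 𝒪 c →+* A).comp (algebraMap _ (PowerSeriesAt 𝒪 c)) =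
      (liftPoly A (fun s => e (X 𝒪 c s)) : MvPolynomial σ 𝒪 →+* A) := by
    have h' : e.comp (IsScalarTower.toAlgHom 𝒪 (MvPolynomial σ 𝒪) (PowerSeriesAt 𝒪 c)) =
        liftPoly A (fun s => e (X 𝒪 c s)) :=
      MvPolynomial.algHom_ext fun s => by rw [AlgHom.comp_apply, toAlgHom_X, liftPoly_X]
    exact congrArg AlgHom.toRingHom h'
  rw [hcomp]
  exact map_pow_pointIdeal_le A _ he n

/-- **Universal property of `𝒪[X_s]^_c`, uniqueness**: two `𝒪`-algebra maps `𝒪[X_s]^_c → A`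
into an object of `Ĉ_𝒪(k)` that agree on the variables are equal. [cite: Mazur1997Deformation, §2] -/
theorem algHom_ext {f g : PowerSeriesAt 𝒪 c →ₐ[𝒪] A} (h : ∀ s, f (X 𝒪 c s) = g (X 𝒪 c s)) :
    f = g := by
  -- they agree on polynomials
  have hpoly : ∀ p : MvPolynomial σ 𝒪,
      f (algebraMap _ (PowerSeriesAt 𝒪 c) p) = g (algebraMap _ (PowerSeriesAt 𝒪 c) p) := by
    intro p
    have hfg : f.comp (IsScalarTower.toAlgHom 𝒪 (MvPolynomial σ 𝒪) (PowerSeriesAt 𝒪 c)) =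
        g.comp (IsScalarTower.toAlgHom 𝒪 (MvPolynomial σ 𝒪) (PowerSeriesAt 𝒪 c)) :=
      MvPolynomial.algHom_ext fun s => by
        rw [AlgHom.comp_apply, AlgHom.comp_apply, toAlgHom_X, h s]
    exact DFunLike.congr_fun hfg p
  refine IsAdicComplete.algHom_ext (maximalIdeal A) fun n => ?_
  apply AlgHom.ext
  intro x
  obtain ⟨p, hp⟩ := exists_sub_algebraMap_mem 𝒪 c n x
  rw [AlgHom.comp_apply, AlgHom.comp_apply, Ideal.Quotient.mkₐ_eq_mk, Ideal.Quotient.eq]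
  have hx : x = (x - algebraMap _ (PowerSeriesAt 𝒪 c) p) + algebraMap _ (PowerSeriesAt 𝒪 c) p := by
    ring
  rw [hx, map_add, map_add, hpoly p, add_sub_add_right_eq_sub]
  exact Ideal.sub_mem _ (map_map_pow_pointIdeal_le hk A f n (Ideal.mem_map_of_mem _ hp))
    (map_map_pow_pointIdeal_le hk A g n (Ideal.mem_map_of_mem _ hp))

/-- **Universal property, combined**: `𝒪`-algebra maps `𝒪[X_s]^_c → A` correspond bijectively to
tuples `a : σ → A` lifting `c`. [cite: Mazur1997Deformation, §2] -/
theorem lift_unique (a : σ → A) (ha : ∀ s, A.residue (a s) = c s)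
    (φ : PowerSeriesAt 𝒪 c →ₐ[𝒪] A) (hφ : ∀ s, φ (X 𝒪 c s) = a s) : φ = lift A a ha :=
  algHom_ext hk A fun s => by rw [hφ, lift_X]

end PowerSeriesAt

end PowerSeriesAt

end Literature.NumberTheory.GaloisRepresentations.Deformation
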